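import Summits.ValiantsHypothesis.ValiantsHypothesis.Theorems.LacunarySymmetroidMatrixDescartesFiniteSectorRealisableEightThree
import Summits.ValiantsHypothesis.ValiantsHypothesis.Theorems.LacunarySymmetroidMatrixDescartesFiniteSectorEtaTwoSix
import Summits.ValiantsHypothesis.ValiantsHypothesis.Theorems.LacunarySymmetroidMatrixDescartesFiniteSectorSigmaKThreeAll
import Summits.ValiantsHypothesis.ValiantsHypothesis.Theorems.LacunarySymmetroidMatrixDescartesFiniteSectorStampCeilingKThreeAll

/-!
# `MatrixDescartes` — line «finite»: the `(8,3)` cell is EXACT on both sides in both currencies: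
# `ν(8,3) = 28` and `η(8,3) = 56` (by name)

HONEST FRAMING.  Object-search cell `pub-symmetroid`, seat val-sym-eng-3 g7 (census/instrument engine #3).  HELPER of
the crux item `stmt-ValiantsHypothesis-18050` (`Theses.LacunarySymmetroid.MatrixDescartes`, asymptotic in `K`) with NO
closure claim — register bookkeeping only, in the pattern of `…FiniteSectorEtaSevenThree` (g6).  The seat's witness
`fullyRealisable_eight_015_twentyeight` (`…FiniteSectorRealisableEightThree`: a symmetric `8 × 8` half-pencil on the
extremal basis `(0,1,5)` — a `7 → 8` EXTENSION of a lifted twin-allowed symmetric tropical design — with a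
full-positive-rooted determinant of degree `28`) is read against the kernel ceilings of the `K = 3` column (closed forms,
all `m`):

* stamp currency: `stampLawAt_K_three 8 _ : StampLawAt 8 3 28` (`…FiniteSectorStampCeilingKThreeAll`, Stöhr's ceiling
  `⌊(m²+6m+1)/4⌋`) and, here, `not_stampLawAt_eight_three_27 : ¬ StampLawAt 8 3 27` — so **`ν(8,3) = 28 = n(8,2)`** exactly;
* sector currency: `hypRootLawAt_K_three_all 8 _ : HypRootLawAt 8 3 56` (`…FiniteSectorSigmaKThreeAll`, Conjecture Σ on the
  `K = 3` column) and, here, `not_hypRootLawAt_eight_three_55 : ¬ HypRootLawAt 8 3 55` by the PROVED doubling `u ↦ u²`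
  (door-p5's adapter `not_hypRootLawAt_of_fullyRealisable`, T2: an in-sector `(8,3)` pencil on `(0,2,10)` of degree `56`) —
  so **`η(8,3) = 56 = σ(8,3)`** exactly.

With `(2,3)` (dense), F4, F5, `(5,3)`, `(6,3)`, `(7,3)` and this cell the `K = 3` column of the instrument table of
`Cruxes/MatrixDescartes/Lines/finite.md` is exact on both sides, by name, for every `m ≤ 8`.  Nothing here bears on the
crux or on `VP ≠ VNP`.  [folklore] Descartes / postage-stamp bookkeeping; no citation exists or is needed.
-/

-- `Summit.ValiantsHypothesis.ValiantsHypothesis.…` repeats a component by the D-0017 layout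
-- (single-conjunct summit), which the `dupNamespace` linter flags; the name is mandated.
set_option linter.dupNamespace false

namespace Summit.ValiantsHypothesis.ValiantsHypothesis.Theorems.LacunarySymmetroidMatrixDescartes.FiniteSector

/-- **`ν(8,3) = 28` is EXACT: the ceiling `27` fails** (witness `fullyRealisable_eight_015_twentyeight` on `(0,1,5)`).
[folklore] -/
theorem not_stampLawAt_eight_three_27 : ¬ StampLawAt 8 3 27 := by
  intro h
  obtain ⟨S, hS, hfull, hdeg⟩ := fullyRealisable_eight_015_twentyeight
  have := h _ S hS hfull
  omega

/-- **`ν(8,3) = 28` EXACT on both sides** (`n(8,2) = 28`: ceiling `stampLawAt_K_three` at `m = 8`, floor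
`not_stampLawAt_eight_three_27`). [folklore] -/
theorem nu_eight_three_exact : StampLawAt 8 3 28 ∧ ¬ StampLawAt 8 3 27 :=
  ⟨stampLawAt_K_three 8 (by norm_num), not_stampLawAt_eight_three_27⟩

/-- **`η(8,3) ≥ 56`**: `¬ HypRootLawAt 8 3 55` — the doubled `(8,3)` realisation
(`fullyRealisable_eight_015_twentyeight`): an in-sector (all roots real and simple) symmetric `(8,3)` pencil on `(0,2,10)`
of degree `56` (adapter `not_hypRootLawAt_of_fullyRealisable`, T2). [folklore] -/
theorem not_hypRootLawAt_eight_three_55 : ¬ HypRootLawAt 8 3 55 :=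
  not_hypRootLawAt_of_fullyRealisable fullyRealisable_eight_015_twentyeight (by norm_num)

/-- **`η(8,3) = 56` EXACT on both sides** (`σ(8,3) = 56 = 2·n(8,2)`: ceiling `hypRootLawAt_K_three_all` at `m = 8`, floor
`not_hypRootLawAt_eight_three_55`). [folklore] -/
theorem eta_eight_three_exact : HypRootLawAt 8 3 56 ∧ ¬ HypRootLawAt 8 3 55 :=
  ⟨hypRootLawAt_K_three_all 8 (by norm_num), not_hypRootLawAt_eight_three_55⟩

end Summit.ValiantsHypothesis.ValiantsHypothesis.Theorems.LacunarySymmetroidMatrixDescartes.FiniteSector
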